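import Literature.NumberTheory.Automorphic.UnitaryGroupArchimedeanPlaces    -- ★ `arch`, `archLocal`, `archAt`, `archPiEquivCM`, `GLnMixedPiEquiv(_apply)`, `evalC`
import Literature.NumberTheory.Rogawski1990.StableConjugacyU3              -- ★ `IsStablyConj`, `isStablyConj_iff`
import HarnessLib

/-!
# Stable conjugacy and conjugacy in `G′_∞ = U(H)(L⁺ ⊗ ℝ) = Π_w U(σ_w H)(ℂ)` are checked PLACE BY PLACE (Borel–Jacquet §4.1; Rogawski 1990 §3.1, §14.2)

Topic `NumberTheory/Automorphic`; namespace `Literature.NumberTheory.Automorphic.UnitaryGroup`.  THEOREMS ONLY (no definition, no instance, no notation, no named fact, no `sorry`).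
Cell `pub/hodgecm-mathlib`, ENGINE T1 (crux H413 = `stmt-HodgeConjecture-24833`); floor-1 preparation, count-neutral, under books rows #88 (ST-∞) ∕ #111 (S-d): road D2′, brick
**«(V8)-glob» FILE 1** (LEAD WORD T7-29, F0P3a-plan (g8), 2026-09-01; author F0P3a-p02 (g9)).  For a CM field `L` (`F = L⁺`, `c` = complex conjugation, no real places) the
archimedean group factorises, ★ `archPiEquivCM : U(H)(L⁺ ⊗ ℝ) ≃ₜ* Π_w U(σ_w H)(ℂ)` and ★ `GLnMixedPiEquiv : GL_N(L ⊗ ℝ) ≃ₜ* Π_w GL_N(ℂ)`; hence both the STABLE conjugacy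
of LETTER #4 ∕ ★ `archStableOrbitalIntegral` (★ `IsStablyConj (conjMixed L⁺ L c) (archFormOf L N H)` = `GL_N(L ⊗ ℝ)`-conjugacy, `Rogawski1990/ArchimedeanTransfer.lean`
:209–220) and honest conjugacy in `G′_∞` hold iff they hold at every complex place `w` (★ `IsStablyConj (starRingEnd ℂ) (σ_w H)` on ★ `archLocal L N H w`).  The two
directions `⇒` of (g1) and `⇐` of (g2) sit INLINE in the proof of ★ `isConj_of_isStablyConj_arch_of_forall_definite` (`ArchLocalStableConjDefinite.lean` :216); here they are
heads, for every `N` and every `H` (no hermitian ∕ non-degeneracy hypothesis is needed).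

* `coe_archPiEquivCM_apply` — the `w`-component of `γ` is `GL_N(evalC w) γ` (definitional);
* **`isStablyConj_arch_iff_forall_place`** (g1) — `γ ∼_st δ` in `U(H)(L⁺ ⊗ ℝ)` iff `γ_w ∼_st δ_w` in `U(σ_w H)(ℂ)` for all `w`;
* **`isConj_arch_iff_forall_place`** (g2) — `γ ∼ δ` iff `γ_w ∼ δ_w` for all `w`; `conjClasses_mk_eq_mk_iff_forall_place` — the same for classes.
Sequel (FILE 2, `ArchStableClassRegularTorus`): the regular stable class of a torus point of `U(diag α)(L⁺ ⊗ ℝ)` listed and counted, and ★ `archStableOrbitalIntegral` at it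
as a `Finset.sum`.  HONEST LABEL: HC_CM is proved only modulo the printed citations until rung 0 closes; this file is group-theoretic book-keeping and pays nothing by itself.

## References
* [BorelJacquet1979] A. Borel, H. Jacquet, *Automorphic forms and automorphic representations*, PSPM 33.1 (1979), §4.1 (`G_∞ = Π_{v∣∞} G(F_v)`).
* [Rogawski1990] J. D. Rogawski, *Automorphic Representations of Unitary Groups in Three Variables*, Ann. of Math. Stud. 123 (1990), §3.1 p. 19 (stable conjugacy),
  §4.1 (4.1.1) p. 39 (`Φ^st` as a sum over the classes inside `𝒪_st(γ)`), §14.2 p. 232 (the archimedean places of the inner form).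
* [PlatonovRapinchuk1994] V. Platonov, A. Rapinchuk, *Algebraic Groups and Number Theory* (1994), §2.3 (unitary groups at the archimedean completions).
-/

set_option autoImplicit false

noncomputable section

open Matrix NumberField NumberField.InfinitePlace NumberField.mixedEmbedding
open scoped MatrixGroups

namespace Literature.NumberTheory.Automorphic

namespace UnitaryGroup

open Literature.NumberTheory.Rogawski1990

section CM

variable (L : Type) [Field L] [NumberField L] [IsCMField L] (N : ℕ) (H : Matrix (Fin N) (Fin N) L)

/-- The `w`-component of `γ ∈ U(H)(L⁺ ⊗ ℝ)` under ★ `archPiEquivCM` is `GL_N(evalC w) γ` (definitional; ★ `coe_archAt`). [cite: BorelJacquet1979, §4.1] -/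
theorem coe_archPiEquivCM_apply (γ : arch (↥(maximalRealSubfield L)) L (IsCMField.complexConj L) N H) (w : {w : InfinitePlace L // IsComplex w}) :
    ((archPiEquivCM N L H γ w : archLocal L N H w) : GL (Fin N) ℂ) =
      Matrix.GeneralLinearGroup.map (evalC L w) (γ : GL (Fin N) (mixedSpace L)) :=
  rfl

/-- **(g1) STABLE CONJUGACY IN `U(H)(L⁺ ⊗ ℝ)` IS CHECKED PLACE BY PLACE**: `γ ∼_st δ` (★ `IsStablyConj (conjMixed) (archFormOf)`: conjugate in `GL_N(L ⊗ ℝ)`) iff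
`γ_w ∼_st δ_w` in `U(σ_w H)(ℂ)` (conjugate in `GL_N(ℂ)`) at every complex place `w` — `⇐` glues the local conjugators with ★ `GLnMixedPiEquiv` (no real places for a
CM field). [cite: BorelJacquet1979, §4.1] [cite: Rogawski1990, §3.1 p. 19; §14.2 p. 232] -/
theorem isStablyConj_arch_iff_forall_place (γ δ : arch (↥(maximalRealSubfield L)) L (IsCMField.complexConj L) N H) :
    IsStablyConj (conjMixed (↥(maximalRealSubfield L)) L (IsCMField.complexConj L)) (archFormOf L N H) γ δ ↔
      ∀ w : {w : InfinitePlace L // IsComplex w},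
        IsStablyConj (starRingEnd ℂ) (H.map w.1.embedding) (archPiEquivCM N L H γ w) (archPiEquivCM N L H δ w) := by
  constructor
  · intro h w
    obtain ⟨g, hg⟩ := isStablyConj_iff.1 h
    refine isStablyConj_iff.2 ⟨Matrix.GeneralLinearGroup.map (evalC L w) g, ?_⟩
    rw [coe_archPiEquivCM_apply, coe_archPiEquivCM_apply, ← map_inv, ← map_mul, ← map_mul, hg]
  · intro h
    choose g hg using fun w => isStablyConj_iff.1 (h w)
    set e := GLnMixedPiEquiv (↥(maximalRealSubfield L)) L (IsCMField.complexConj L) N (IsCMField.complexConj_ne_one L)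
      (complexConj_smul_infinitePlace L) with he
    refine isStablyConj_iff.2 ⟨e.symm g, e.injective ?_⟩
    rw [map_mul, map_mul, map_inv, ContinuousMulEquiv.apply_symm_apply]
    funext w
    rw [Pi.mul_apply, Pi.mul_apply, Pi.inv_apply, he, GLnMixedPiEquiv_apply, GLnMixedPiEquiv_apply]
    exact hg w

/-- **(g2) CONJUGACY IN `U(H)(L⁺ ⊗ ℝ)` IS CHECKED PLACE BY PLACE**: `γ ∼ δ` in `G′_∞` iff `γ_w ∼ δ_w` in `U(σ_w H)(ℂ)` at every complex place `w` (★ `archPiEquivCM` is a group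
isomorphism onto the product). [cite: BorelJacquet1979, §4.1] [cite: Rogawski1990, §14.2 p. 232] -/
theorem isConj_arch_iff_forall_place (γ δ : arch (↥(maximalRealSubfield L)) L (IsCMField.complexConj L) N H) :
    IsConj γ δ ↔ ∀ w : {w : InfinitePlace L // IsComplex w}, IsConj (archPiEquivCM N L H γ w) (archPiEquivCM N L H δ w) := by
  set e := archPiEquivCM N L H with he
  constructor
  · intro h w
    exact (Pi.evalMonoidHom (fun w : {w : InfinitePlace L // IsComplex w} => archLocal L N H w) w).map_isConj
      (e.toMulEquiv.toMonoidHom.map_isConj h)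
  · intro h
    choose u hu using fun w => isConj_iff.1 (h w)
    refine isConj_iff.2 ⟨e.symm u, e.injective ?_⟩
    rw [map_mul, map_mul, map_inv, ContinuousMulEquiv.apply_symm_apply]
    funext w
    exact hu w

/-- Classes: `⟦γ⟧ = ⟦δ⟧` in `ConjClasses G′_∞` iff `⟦γ_w⟧ = ⟦δ_w⟧` at every complex place. [cite: BorelJacquet1979, §4.1] -/
theorem conjClasses_mk_eq_mk_iff_forall_place (γ δ : arch (↥(maximalRealSubfield L)) L (IsCMField.complexConj L) N H) :
    ConjClasses.mk γ = ConjClasses.mk δ ↔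
      ∀ w : {w : InfinitePlace L // IsComplex w}, ConjClasses.mk (archPiEquivCM N L H γ w) = ConjClasses.mk (archPiEquivCM N L H δ w) := by
  rw [ConjClasses.mk_eq_mk_iff_isConj, isConj_arch_iff_forall_place]
  exact forall_congr' fun w => ConjClasses.mk_eq_mk_iff_isConj.symm

/-- Stable conjugacy in `G′_∞` from honest conjugacy (★ `isStablyConj_of_isConj`, recorded on the `arch` carrier for the sequel). [cite: Rogawski1990, §3.1 p. 19] -/
theorem isStablyConj_arch_of_isConj {γ δ : arch (↥(maximalRealSubfield L)) L (IsCMField.complexConj L) N H} (h : IsConj γ δ) :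
    IsStablyConj (conjMixed (↥(maximalRealSubfield L)) L (IsCMField.complexConj L)) (archFormOf L N H) γ δ :=
  isStablyConj_of_isConj h

end CM

end UnitaryGroup

end Literature.NumberTheory.Automorphic

end
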